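/-
Copyright (c) 2026. All rights reserved.
Released under Apache 2.0 license as described in the file LICENSE.
Authors: abc-iut cell, wave-3 discharge prover seat abc-iut-L6-d4.
-/
import Literature.IUT.LogThetaLattice.RealifiedSemisimplification
import Literature.AnabelianGeometry.AbsoluteAnabelian.LocalVolumesNonarchimedean
import Literature.AnabelianGeometry.AbsoluteAnabelian.LocalVolumesArchimedeanProofs
import HarnessLib

/-!
# [IUTchIII] Remark 3.9.4 (iv), (vi): the embedding `1 ↦ −log(q)` and the archimedean log-link
# compatibility at the REAL objects — proof companion of `RealifiedSemisimplification.lean` (part B)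

S. Mochizuki, *Inter-universal Teichmüller theory III*, kurims manuscript (May 2020) of PRIMS **57**
(2021), §3, Remark 3.9.4 (iv) p. 124, (vi) pp. 125–126 (read on the page). PROOF-ONLY companion (no
definitions) of `Literature/IUT/LogThetaLattice/RealifiedSemisimplification.lean` (statement file, seat
abc-iut-L6-t4, p404272; nodes IUTchIII:Rmk3.9.4(iv), IUTchIII:Rmk3.9.4(vi); part (iii) is
`RealifiedSemisimplificationProofs.lean`). The statement file types both sentences as predicates over
ABSTRACT data (`q`, `O`, `lvol`, `ordq`, `pv`; `L`, `expk`, `volAng`, `volLin`), TODO-merge [AbsTopIII]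
Prop. 5.7. Here:

* (iv) `Remark394iv_qEmbedding_piPow` — with `O := 𝒪_k = closedBall 0 1`, `lvol := μ_k^log = localLogVolume K`
  (abc-iut-L4-t3; the [AbsTopIII] Prop. 5.7 (i) normalisation `μ^log(𝔪_k^n) = −n·f·log p`) and `q := ϖ^m`:
  `μ_k^log(q^n · 𝒪_k) = −(n · ((m·f) · log p))`, i.e. the embedding `ℕ ↪ Rss(k) → ℝ ∪ {−∞}`, `1 ↦ −log(q)` of
  p. 124 in the tree's normalisation (`m·f·log p = [k : ℚ_p] · ord_v(q) · log p` with `ord_v(p_v) = 1`,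
  Rmk. 2.4.2 (ii); the printed "[normalized] log-volume" divides by `[k : ℚ_p]`, Prop. 3.9 (i)).
* (vi) `Remark394vi_expPreservesVolume_of_isCompact` — `k = ℂ`, `L := log_k(𝒪^×_k) = iℝ`, `expk := exp`,
  `volAng :=` the angular volume `μ̆_k` = arc length on `𝒪^×_k = S¹` (abc-iut-L4-t3
  `ComplexVolume.angularVolume`, Haar measure of mass `2π` on `ℝ/2πℤ` of the `phase`-image), `volLin :=`
  Lebesgue measure along `iℝ`: for COMPACT `S ⊆ iℝ` on which `exp` is injective, `μ̆_k(exp(S)) = volLin(S)` (via abc-iut-L4-t8's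
  `ComplexVolume.volume_image_coe_addCircle_of_injOn`, [AbsTopIII] Prop. 5.7 (ii)(c)). NOTE recorded for
  the owner of the statement file (finding on HOME/INBOX): the typed `Remark394vi_expPreservesVolume`
  quantifies over ALL `S ⊆ L` (no pre-ample / Borel / compact hypothesis, unlike (iii)); at this honest
  instantiation it is classically FALSE for non-measurable `S` (Bernstein-type decomposition of
  `[0, 2π)`), so the compact (printed: "ample") form is what is proved here.

Classical content; nothing here bears on [IUTchIII] Cor. 3.12; tag form [claim: Mochizuki2012,
status: disputed] on the discharges (their statements are the disputed paper's sentences).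
-/

set_option autoImplicit false

noncomputable section

open MeasureTheory MeasureTheory.Measure Set Metric TopologicalSpace
open scoped ENNReal NNReal Pointwise

namespace Literature.IUT.LogThetaLattice

/-! ## §1 Remark 3.9.4 (iv): the embedding `ℕ ∋ 1 ↦ −log(q)` -/

section Rmk394iv

open Literature.AnabelianGeometry.AbsoluteAnabelian
open Literature.NumberTheory.GaloisRepresentations.Ultrametric

variable (K : Type*) [NontriviallyNormedField K] [IsUltrametricDist K] [ProperSpace K]
  [MeasurableSpace K] [BorelSpace K]

/-- **IUTchIII:Rmk3.9.4(iv), DISCHARGED in the tree's normalisation** (kurims p. 124: "applying the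
[normalized] log-volume to the image of `𝒪_k ⊆ k` via multiplication by elements of this submonoid
[`q^ℕ`], an embedding `ℕ ↪ Rss(k) → ℝ ∪ {−∞}` that maps `ℕ ∋ 1 ↦ −log(q) ∈ ℝ`"): with `O := 𝒪_k`,
`lvol := μ_k^log = localLogVolume K` ([AbsTopIII] Prop. 5.7 (i): `μ_k^log(𝔪_k^n) = −n·f·log p` when the
residue field has `p^f` elements) and `q := ϖ^m` for any `ϖ` with `‖ϖ‖ ≤ 1`, `[𝒪 : ϖ𝒪] = p^f`:
`μ_k^log(q^n · 𝒪_k) = −(n · ((m·f) · log p))`. For a uniformiser `ϖ`, `m·f·log p = [k : ℚ_p]·ord_v(q)·log p`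
with `ord_v(p_v) = 1`, i.e. `[k : ℚ_p]` times the printed normalized value (the statement file's `ordq`
slot receives the 𝒪-index exponent `m·f`). [claim: Mochizuki2012, status: disputed] -/
theorem Remark394iv_qEmbedding_piPow {ϖ : Kˣ} (hϖ : ‖(ϖ : K)‖ ≤ 1) {p f : ℕ}
    (hq : resIndex ϖ = p ^ f) (m : ℕ) :
    Remark394iv_qEmbedding ((ϖ : K) ^ m) (closedBall (0 : K) 1) (localLogVolume K) (m * f) p := by
  intro n
  have hset : (fun x : K => ((ϖ : K) ^ m) ^ n * x) '' closedBall (0 : K) 1 =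
      (ϖ ^ (m * n) : Kˣ) • closedBall (0 : K) 1 := by
    rw [← Set.image_smul]
    refine Set.image_congr' fun x => ?_
    rw [Units.smul_def, smul_eq_mul, Units.val_pow_eq_pow_val, pow_mul]
  rw [hset, localLogVolume_piBall_pow_eq (K := K) hϖ hq (m * n)]
  push_cast
  ring

end Rmk394iv

/-! ## §2 Remark 3.9.4 (vi): `volAng(exp_k(S)) = volLin(S)` for compact `S ⊆ log_k(𝒪^×_k) = iℝ` -/

section Rmk394vi

open Complex Literature.AnabelianGeometry.AbsoluteAnabelian

/-- The projection to `𝒪_k^× = ℝ/2πℤ` of `exp_k(it)` is `t mod 2π`; file-private helper. [folklore] -/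
private theorem phase_exp_ofReal_mul_I (t : ℝ) :
    ComplexVolume.phase (exp (t * I)) = ((t : ℝ) : AddCircle (2 * Real.pi)) := by
  unfold ComplexVolume.phase
  rw [arg_exp_mul_I]
  exact Real.Angle.coe_toIocMod t (-Real.pi)

/-- **IUTchIII:Rmk3.9.4(vi), compact form, DISCHARGED** (kurims pp. 125–126: the diagram
`|k| ↞ k ⊇ 𝒪^×_k ←^{exp_k} log_k(𝒪^×_k) ⊆ k ↠ |k|` "induces `ℝ_{>0}`-equivariant isomorphisms of monoids on
the respective realified semi-simplifications … compatible with the [radial/angular] log-volume map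
of [AbsTopIII], Proposition 5.7, (ii), (a)" — the log-link compatibility at `v ∈ 𝕍^arc`): with `k = ℂ`,
`L := log_k(𝒪^×_k) = iℝ`, `expk := exp`, `volAng :=` the angular volume `μ̆_k` of [AbsTopIII] Prop. 5.7 (ii)(a)
(abc-iut-L4-t3 `ComplexVolume.angularVolume`: arc length on `𝒪^×_k = S¹`, i.e. the Haar measure of mass
`2π` on `ℝ/2πℤ` of the `phase`-image) and `volLin :=` Lebesgue measure along `iℝ`: for every COMPACT
`S ⊆ iℝ` on which `exp` is injective, `μ̆_k(exp(S)) = volLin(S)` (as real numbers; both are finite). The statement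
file's `Remark394vi_expPreservesVolume` omits the (pre-)ample hypothesis on `S` and is, at this
instantiation, classically false for non-measurable `S`; this is the printed ("ample") content.
[claim: Mochizuki2012, status: disputed] -/
theorem Remark394vi_expPreservesVolume_of_isCompact {S : Set ℂ} (hSL : S ⊆ {z : ℂ | z.re = 0})
    (hSc : IsCompact S) (hinj : InjOn exp S) :
    ComplexVolume.angularVolume (exp '' S) = (volume (Complex.im '' S)).toReal := by
  unfold ComplexVolume.angularVolume
  congr 1
  -- points of `S` are `i·t`
  have hz : ∀ z ∈ S, ((z.im : ℝ) : ℂ) * I = z := fun z hzS => by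
    have hre : z.re = 0 := hSL hzS
    apply Complex.ext <;> simp [hre]
  have himage : ComplexVolume.phase '' (exp '' S) =
      (fun t : ℝ => (t : AddCircle (2 * Real.pi))) '' (Complex.im '' S) := by
    rw [image_image, image_image]
    refine Set.image_congr fun z hzS => ?_
    conv_lhs => rw [← hz z hzS]
    exact phase_exp_ofReal_mul_I z.im
  rw [himage]
  -- the `Fact (0 < 2π)` instance of the angular volume (any two are definitionally equal)
  haveI : Fact (0 < 2 * Real.pi) := ⟨Real.two_pi_pos⟩
  apply ComplexVolume.volume_image_coe_addCircle_of_injOn (hSc.image Complex.continuous_im)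
  -- `t ↦ t mod 2π` is injective on `im(S)` because `exp` is injective on `S`
  rintro _ ⟨z₁, hz₁, rfl⟩ _ ⟨z₂, hz₂, rfl⟩ h
  have hmem : z₁.im - z₂.im ∈ AddSubgroup.zmultiples (2 * Real.pi) :=
    QuotientAddGroup.eq_iff_sub_mem.mp h
  obtain ⟨k, hk⟩ := AddSubgroup.mem_zmultiples_iff.mp hmem
  have hr : z₁.im = z₂.im + k * (2 * Real.pi) := by rw [zsmul_eq_mul] at hk; linarith
  have hexp : exp z₁ = exp z₂ := by
    rw [← hz z₁ hz₁, ← hz z₂ hz₂]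
    refine Complex.exp_eq_exp_iff_exists_int.mpr ⟨k, ?_⟩
    rw [hr]
    push_cast
    ring
  exact congrArg Complex.im (hinj hz₁ hz₂ hexp)

end Rmk394vi

end Literature.IUT.LogThetaLattice

end
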